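import Summits.QuantumAdvantage.QuantumAdvantage.Theorems.CubicForrelationNearExactIsExactRothausB

/-!
# Crux `CubicForrelation.NearExactIsExact` (stmt-QuantumAdvantage-14043), line `direct-sum-amplification` —
stub HOU: Hou's degree bound for the dual of a cubic bent function

In the tree's `Bool` / `IsDegLeFun` / `W` vocabulary (`stub_houCubic`): GIVEN Ax's parity theorem on coordinate
cubes (the hypothesis `hAx`, verbatim the statement of the landed `stub_axParity`: for `h` of degree `≤ d`, `d ≥ 1`,
`Σ_{x ∈ E_K} (−1)^{h(x)} ∈ 2^{⌈|K|/d⌉} ℤ`), the dual `d` of a CUBIC bent function `g` on `m + m` bits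
(`W_g = 2^m (−1)^d`) has algebraic degree `≤ ⌊(m+3)/2⌋` (Hou 2000; Carlet 2021 Prop. 74 with `deg g = 3`). This is
exactly the hypothesis `hHou` of the landed `bb_band_of_small_m` (BentDuality file), so — with the unconditional
Reed–Muller minimum-weight statement `bb_rmWeight_holds` (RothausB file) — the bent-sided band
`Φ(f,g) = 1 ∨ Φ(f,g) ≤ 31/32` for cubic `f` and cubic bent `g` on `m + m ≤ 20` bits follows from `hAx` alone
(`hou_band_m_le_ten`).

Proof (Rothaus' parity method, as in `bb_rothaus_isDegLeFun`, with Ax's theorem feeding the right-hand side). By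
Möbius inversion (`bb_moebius_isDegLeFun`) it suffices to show that for every coordinate set `I` with
`|I| = i > ⌊(m+3)/2⌋` the count `A = #{u ∈ E_I : d u = 1}` is even. POISSON (`bb_poisson`) over the cube `E_I`
against the dual form gives `2^m (2^i − 2A) = 2^i Σ_{x ∈ E_{Iᶜ}} (−1)^{g(x)}`, and AX with `K = Iᶜ`
(`|K| = 2m − i`, `d = 3`) writes the inner sum as `2^c z` with `c = ⌈(2m − i)/3⌉`. Hence
`2^{m+1} A = 2^{m+i} − 2^{i+c} z` in `ℤ`; since `i ≥ 2` and `i + c ≥ m + 2` (pure arithmetic from `i > ⌊(m+3)/2⌋`,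
`i ≤ 2m`), `2^{m+2}` divides the right side, so `A` is even (`hou_even_of_balance`). For `m ≤ 1` no `I` has
`|I| > ⌊(m+3)/2⌋ ≥ m + m`, so the same argument covers every `m`.

Sources: X.-D. Hou, *Cubic bent functions*, Discrete Math. 189 (1998) 149–161, and *New constructions of bent
functions*, 2000; C. Carlet, *Boolean Functions for Cryptography and Coding Theory*, CUP 2021, Prop. 74 and
Thm 13 (Rothaus' parity method); O. S. Rothaus, *On "bent" functions*, JCTA 20 (1976). Everything below is proved
from Mathlib and the tree (`bb_poisson`, `bb_moebius_isDegLeFun`, `bb_sum_signOf`, `bb_card_cube`,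
`bb_band_of_small_m`, `bb_rmWeight_holds`); axioms are the standard three. Imports: the RothausB file (which brings the
Rothaus file and `bb_rmWeight_holds`); the Theses file is deliberately NOT imported.
-/

set_option linter.dupNamespace false -- D-0017: single-problem summit ⇒ `QuantumAdvantage.QuantumAdvantage` by design

noncomputable section

namespace Summit.QuantumAdvantage.QuantumAdvantage.Theorems.CubicForrelation.NearExactIsExact

open Finset
open Literature.Computability.QuantumComplexity
open Literature.Computability.QuantumComplexity.DerivativeWalsh (W)

/-- The arithmetic of the evenness step in Hou's bound: if `2 ≤ i`, `m + 2 ≤ i + c` and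
`2^m (2^i − 2A) = 2^i (2^c z)` in `ℤ`, then `A` is even (`2^{m+1} A = 2^{m+i} − 2^{i+c} z` is divisible by
`2^{m+2}`). -/
theorem hou_even_of_balance {m i c A : ℕ} {z : ℤ} (hi : 2 ≤ i) (hic : m + 2 ≤ i + c)
    (h : (2 : ℤ) ^ m * (2 ^ i - 2 * A) = 2 ^ i * (2 ^ c * z)) : Even A := by
  have h1 : (2 : ℤ) ^ (m + 1) * A = 2 ^ (m + i) - 2 ^ (i + c) * z := by
    rw [pow_add, pow_add, pow_succ]
    linear_combination -h
  have h2 : (2 : ℤ) ^ (m + 1) * 2 ∣ 2 ^ (m + 1) * A := by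
    rw [h1, ← pow_succ]
    exact dvd_sub (pow_dvd_pow 2 (by omega)) (dvd_mul_of_dvd_left (pow_dvd_pow 2 (by omega)) z)
  have h3 : (2 : ℤ) ∣ (A : ℤ) := (mul_dvd_mul_iff_left (by positivity)).1 h2
  exact even_iff_two_dvd.2 (by exact_mod_cast h3)

/-- **stub_houCubic** (HOU; Hou 2000 / Carlet 2021 Prop. 74 specialised to cubic bent functions): GIVEN Ax's parity
theorem on coordinate cubes (`hAx`, the statement of `stub_axParity`), the dual `d` of a cubic bent function `g` on
`m + m` bits (`W_g = 2^m (−1)^d`) has algebraic degree `≤ ⌊(m+3)/2⌋`. Proof: for every coordinate set `I` with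
`|I| > ⌊(m+3)/2⌋`, Poisson summation over `E_I` against the dual form and Ax's theorem on `E_{Iᶜ}` (`d = 3`) show
that `#{u ∈ E_I : d u = 1}` is even (`hou_even_of_balance`); conclude by Möbius inversion (`bb_moebius_isDegLeFun`).
Exactly the hypothesis `hHou` of `bb_band_of_small_m`. -/
theorem stub_houCubic :
    (∀ (n d : ℕ) (h : (Fin n → Bool) → Bool) (K : Finset (Fin n)), 1 ≤ d → IsDegLeFun d h →
      ∃ z : ℤ, ∑ x ∈ {u : Fin n → Bool | ∀ i, u i = true → i ∈ K}, signOf (h x) =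
        (2 : ℝ) ^ ((K.card + d - 1) / d) * (z : ℝ)) →
    ∀ (m : ℕ) (g d : (Fin (m + m) → Bool) → Bool), IsDegLeFun 3 g →
      (∀ x, W (fun y => signOf (g y)) x = (2 : ℝ) ^ m * signOf (d x)) → IsDegLeFun ((m + 3) / 2) d := by
  intro hAx m g d hg hd
  refine bb_moebius_isDegLeFun ((m + 3) / 2) d fun I hI => ?_
  have hP := bb_poisson (fun y => signOf (g y)) I
  obtain ⟨z, hz⟩ := hAx (m + m) 3 g Iᶜ (by norm_num) hg
  generalize hc : (Iᶜ.card + 3 - 1) / 3 = c at hz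
  rw [sum_congr rfl fun u _ => hd u, ← mul_sum, hz, bb_sum_signOf, bb_card_cube] at hP
  push_cast at hP
  set A := #{u : Fin (m + m) → Bool | (∀ i, u i = true → i ∈ I) ∧ d u = true}
  have hk : #I ≤ m + m := (card_le_univ I).trans_eq (Fintype.card_fin (m + m))
  have hj : #Iᶜ = m + m - #I := by rw [card_compl, Fintype.card_fin]
  refine hou_even_of_balance (m := m) (i := #I) (c := c) (z := z) (by omega) (by omega) ?_
  have h' : (((2 : ℤ) ^ m * (2 ^ #I - 2 * (A : ℤ)) : ℤ) : ℝ) =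
      (((2 : ℤ) ^ #I * (2 ^ c * z) : ℤ) : ℝ) := by
    push_cast
    linear_combination hP
  exact_mod_cast h'

/-- **The bent-sided band for `n ≤ 20`, given only Ax's parity theorem on cubes** (`hAx`, the statement of
`stub_axParity`): for `m ≤ 10`, every cubic `f` and every cubic bent `g` (`W_g(x)² = 2^{m+m}` for all `x`) on
`m + m` bits satisfy `Φ(f,g) = 1 ∨ Φ(f,g) ≤ 31/32` — the landed `bb_band_of_small_m` fed with the unconditional
Reed–Muller minimum weight `bb_rmWeight_holds` and Hou's bound `stub_houCubic hAx` (`deg g̃ ≤ ⌊13/2⌋ = 6`). -/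
theorem hou_band_m_le_ten
    (hAx : ∀ (n d : ℕ) (h : (Fin n → Bool) → Bool) (K : Finset (Fin n)), 1 ≤ d → IsDegLeFun d h →
      ∃ z : ℤ, ∑ x ∈ {u : Fin n → Bool | ∀ i, u i = true → i ∈ K}, signOf (h x) =
        (2 : ℝ) ^ ((K.card + d - 1) / d) * (z : ℝ)) :
    ∀ (m : ℕ) (f g : (Fin (m + m) → Bool) → Bool), m ≤ 10 → IsDegLeFun 3 f → IsDegLeFun 3 g →
      (∀ x, W (fun y => signOf (g y)) x ^ 2 = (2 : ℝ) ^ (m + m)) →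
      forrelation f g = 1 ∨ forrelation f g ≤ 31 / 32 :=
  fun m f g hm hf hg hb => bb_band_of_small_m bb_rmWeight_holds (stub_houCubic hAx) m hm f g hf hg hb

end Summit.QuantumAdvantage.QuantumAdvantage.Theorems.CubicForrelation.NearExactIsExact
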